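import Literature.NumberTheory.EllipticCurves.ZpExtensionEisensteinDVRSettingH4TowerPairingProofs
import Literature.NumberTheory.GaloisCohomology.Howard2004.DualityDatumLocalCupAnnihilatorProofs
import Literature.NumberTheory.GaloisCohomology.Howard2004.KolyvaginSystemReindex
import Literature.NumberTheory.EllipticCurves.IwasawaAlgebraEisensteinValueTowerProofs
import HarnessLib

/-!
# H.4 at the places `v ∈ S` for the curve's Eisenstein setting, II: the duality inputs (Perf) and (Nondeg)
# of the descent at the induced local pairings of the levels

`Proofs` file (theorems only; no definition, no named fact, no instance, no `sorry`).  Sequel of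
`ZpExtensionEisensteinDVRSettingH4TowerPairingProofs` ((hB), (hQ), (T)).

Howard 2004, H.4 at `v ∈ S` for `F_𝔮` (Def. 3.1.2) is obtained in the tree from the abstract descent over the tower of
induced local pairings `∪_j : H¹(K_v, T^{(j)}) × H¹(K_v, Tw T^{(j)}) → H²(K_v, A_{m,j+1}(1))`; its duality clause (Dual) is
`Tower.mem_levelCondition_top_of_forall_pairing_bot_eq_zero_of_range` (x9-p1-w4), whose level inputs at the base level
`k` are (Perf) «a class orthogonal to the annihilator of `range (red′^{(d)})` lies in that range» and (Nondeg) «both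
kernels of `∪_{k+d}` are trivial», besides (Adj) and (Ker).  For Howard's `R(1)`-valued pairings (Perf) holds for
`R`-STABLE subgroups (`DualityDatum.mem_of_forall_localCup_annihilator_eq_zero_of_isPerfect`: finite-level Tate duality
read through a dualizing family of `R = A_{m,k+1}`), and the images of the iterated reductions are `R`-stable because
the reductions are semilinear over the SURJECTIVE ring maps `A_{m,k+d+1} → A_{m,k+1}`.  This file instantiates all of
that for the curve's tower `W.eisensteinTower κ hm` and ANY H.4 data `D k` over `A_{m,k+1}`, given only the Poitou–Tate
named fact `poitouTate_selmerStructure_duality K` (a hypothesis):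

* §1 (generic, any `AdicTower`, any conjugation datum) `AdicTower.redIter_cohomologyMap_toLocal[_twist]_eq`: the
  iterated reduction `Tower.redIter` of the local `H¹`-towers `j ↦ H¹(K_v, T_j)`, `j ↦ H¹(K_v, Tw T_j)` (one-step maps
  `H¹(red_j)`) IS `H¹` of the module-level iterate `T.redIter k d`.
* §2 `eisensteinTower_redIter_smul`: `red^{(d)}(a · x) = reduce(a) · red^{(d)} x` (semilinearity over
  `reduce : A_{m,k+d+1} → A_{m,k+1}`), hence `range H¹(K_v, Tw red^{(d)})` is stable under the scalar action of
  `A_{m,k+1}` (`DualityDatum.scalarMapH1_twist_toLocal_mem_range`).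
* §3 (Perf) `eisensteinTower_mem_range_of_forall_localCup_annihilator`, (Nondeg) `eisensteinTower_localCup_nondegenerate`
  (the bridge `λ_{k+1}`, `exp = log⁻¹`, `Θ` bijective, dual family — the pattern of
  `eisensteinTower_isSelfOrthogonalAt_of_not_mem`).
* §4 both packaged in the binder shapes `hPerf`, `hNondeg` of
  `Tower.mem_levelCondition_top_of_forall_pairing_bot_eq_zero_of_range` for the `D`-indexed towers
  `X_j = H¹(K_v, T^{(j)})`, `Y_j = H¹(K_v, Tw T^{(j)})`, `B_j = (D j).localCup (Sum.inr v)`.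

Cell `pub/bsd-print-x9` (STUB A, `hfin4`); (Adj), (Ker), (Exact), (hC) are other files.  No summit statement is proved
here; BSD is not proved by any of this.  References: [Howard2004HeegnerKolyvagin] §1.3 H.4 (arXiv p. 7 L78–82), Def. 1.1.1,
§1.6 (p. 12), Def. 3.1.2; [MilneADT2006] I §0 Prop. 0.19, Cor. 2.3; [SerreGaloisCohomology1997] I §2.2, §5.1.
-/

set_option autoImplicit false

noncomputable section

open Function NumberField IsDedekindDomain Field
open scoped NumberField ContRepresentation

/-! ## §1 `Tower.redIter` of the local `H¹`-towers is `H¹` of the module-level iterate -/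

namespace Literature.NumberTheory.GaloisCohomology.Howard2004.AdicTower

open Literature.NumberTheory.GaloisRepresentations Literature.NumberTheory.GaloisRepresentations.DiscreteGaloisModule
open Literature.NumberTheory.EllipticCurves

variable {K : Type} [Field K] [NumberField K] {R : Type} [CommRing R] [IsLocalRing R]
  {N : ℕ → Type} [∀ k, AddCommGroup (N k)] [∀ k, TopologicalSpace (N k)] [∀ k, DiscreteTopology (N k)]
  [∀ k, Module R (N k)]

/-- **`red^{(d)}` on `H¹(K_v, T_•)` is `H¹(K_v, red^{(d)})`**: the iterate `Tower.redIter` of the one-step maps `H¹(red_j)`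
of the local tower equals `H¹` of `T.redIter k d` (functoriality of `H¹`). [cite: Howard2004HeegnerKolyvagin, §1.6 (arXiv p. 12, L29–33)]
[cite: SerreGaloisCohomology1997, I §2.2] -/
theorem redIter_cohomologyMap_toLocal_eq (T : AdicTower K R N) (v : Place K) (k : ℕ) :
    ∀ (d : ℕ) (y : galoisCohomology ((T.ρ (k + d)).toLocal v) 1),
      Tower.redIter (H := fun j ↦ galoisCohomology ((T.ρ j).toLocal v) 1)
          (fun j ↦ ContinuousRep.cohomologyMap ((T.ρ (j + 1)).toLocal v) ((T.ρ j).toLocal v) (T.red j).toAddMonoidHom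
            continuous_of_discreteTopology (fun _ z => T.red_equivariant j _ z) 1) k d y =
        ContinuousRep.cohomologyMap ((T.ρ (k + d)).toLocal v) ((T.ρ k).toLocal v) (T.redIter k d).toAddMonoidHom
          continuous_of_discreteTopology (fun _ z => T.redIter_equivariant k d _ z) 1 y
  | 0, y => (cohomologyMap_one_id_apply _ _ _ (fun _ => rfl) y).symm
  | d + 1, y => by
    rw [Tower.redIter_succ, redIter_cohomologyMap_toLocal_eq T v k d]
    exact cohomologyMap_one_comp_eq _ _ _ _ _ _ _ _ _ (fun _ => rfl) y

/-- The same as an identity of maps. [cite: Howard2004HeegnerKolyvagin, §1.6 (arXiv p. 12)] [cite: SerreGaloisCohomology1997, I §2.2] -/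
theorem redIter_cohomologyMap_toLocal_eq' (T : AdicTower K R N) (v : Place K) (k d : ℕ) :
    Tower.redIter (H := fun j ↦ galoisCohomology ((T.ρ j).toLocal v) 1)
        (fun j ↦ ContinuousRep.cohomologyMap ((T.ρ (j + 1)).toLocal v) ((T.ρ j).toLocal v) (T.red j).toAddMonoidHom
          continuous_of_discreteTopology (fun _ z => T.red_equivariant j _ z) 1) k d =
      ContinuousRep.cohomologyMap ((T.ρ (k + d)).toLocal v) ((T.ρ k).toLocal v) (T.redIter k d).toAddMonoidHom
        continuous_of_discreteTopology (fun _ z => T.redIter_equivariant k d _ z) 1 :=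
  AddMonoidHom.ext (T.redIter_cohomologyMap_toLocal_eq v k d)

/-- **`red^{(d)}` on `H¹(K_v, Tw T_•)` is `H¹(K_v, Tw red^{(d)})`** (the conjugate-twisted tower of a conjugation datum).
[cite: Howard2004HeegnerKolyvagin, §1.3 (Tw) and §1.6 (arXiv p. 12)] [cite: SerreGaloisCohomology1997, I §2.2] -/
theorem redIter_cohomologyMap_twist_toLocal_eq (T : AdicTower K R N) (cd : ConjugationDatum K) (v : Place K) (k : ℕ) :
    ∀ (d : ℕ) (y : galoisCohomology ((cd.twist (T.ρ (k + d))).toLocal v) 1),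
      Tower.redIter (H := fun j ↦ galoisCohomology ((cd.twist (T.ρ j)).toLocal v) 1)
          (fun j ↦ ContinuousRep.cohomologyMap ((cd.twist (T.ρ (j + 1))).toLocal v) ((cd.twist (T.ρ j)).toLocal v)
            (T.red j).toAddMonoidHom continuous_of_discreteTopology (fun _ z => T.red_equivariant j _ z) 1) k d y =
        ContinuousRep.cohomologyMap ((cd.twist (T.ρ (k + d))).toLocal v) ((cd.twist (T.ρ k)).toLocal v)
          (T.redIter k d).toAddMonoidHom continuous_of_discreteTopology (fun _ z => T.redIter_equivariant k d _ z) 1 y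
  | 0, y => (cohomologyMap_one_id_apply _ _ _ (fun _ => rfl) y).symm
  | d + 1, y => by
    rw [Tower.redIter_succ, redIter_cohomologyMap_twist_toLocal_eq T cd v k d]
    exact cohomologyMap_one_comp_eq _ _ _ _ _ _ _ _ _ (fun _ => rfl) y

/-- The same as an identity of maps. [cite: Howard2004HeegnerKolyvagin, §1.3 and §1.6 (arXiv p. 12)] [cite: SerreGaloisCohomology1997, I §2.2] -/
theorem redIter_cohomologyMap_twist_toLocal_eq' (T : AdicTower K R N) (cd : ConjugationDatum K) (v : Place K)
    (k d : ℕ) :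
    Tower.redIter (H := fun j ↦ galoisCohomology ((cd.twist (T.ρ j)).toLocal v) 1)
        (fun j ↦ ContinuousRep.cohomologyMap ((cd.twist (T.ρ (j + 1))).toLocal v) ((cd.twist (T.ρ j)).toLocal v)
          (T.red j).toAddMonoidHom continuous_of_discreteTopology (fun _ z => T.red_equivariant j _ z) 1) k d =
      ContinuousRep.cohomologyMap ((cd.twist (T.ρ (k + d))).toLocal v) ((cd.twist (T.ρ k)).toLocal v)
        (T.redIter k d).toAddMonoidHom continuous_of_discreteTopology (fun _ z => T.redIter_equivariant k d _ z) 1 :=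
  AddMonoidHom.ext (T.redIter_cohomologyMap_twist_toLocal_eq cd v k d)

end Literature.NumberTheory.GaloisCohomology.Howard2004.AdicTower

/-! ## §§2–4 The curve's Eisenstein tower -/

namespace WeierstrassCurve

open Literature.NumberTheory.EllipticCurves Literature.NumberTheory.GaloisRepresentations
open Literature.NumberTheory.GaloisRepresentations.DiscreteGaloisModule
open Literature.NumberTheory.GaloisCohomology Literature.NumberTheory.GaloisCohomology.Howard2004
open Literature.NumberTheory.EllipticCurves.ZpExtension (EisensteinLevel)

variable {K : Type} [Field K] [NumberField K] (W : WeierstrassCurve ℚ) [W.IsElliptic] {p : ℕ} [hp : Fact p.Prime]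
  (κ : ZpExtension K p) {m : ℕ} (hm : 1 ≤ m)

/-! ### §2 Semilinearity of the iterated reduction and `R`-stability of its twisted image -/

/-- **`red^{(d)} (a · x) = reduce(a) · red^{(d)} x`**: the iterated reduction `T^{(k+d)} → T^{(k)}` of the curve's tower is
semilinear over the ring reduction `A_{m,k+d+1} → A_{m,k+1}` (both scalar actions come from `S_m = Λ/(T^m+p)`, over which
the reductions are linear). [cite: Howard2004HeegnerKolyvagin, §1.6 (arXiv p. 11 L13–20, p. 12 L29–33) and Def. 1.1.3] -/
theorem eisensteinTower_redIter_smul (k d : ℕ) (a : IwasawaAlgebra.EisensteinCoeff p m (k + d + 1))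
    (x : EisensteinLevel p m (fun j ↦ geomTorsion (W.baseChange K) ((p : ℤ) ^ j)) (k + d + 1)) :
    letI := IwasawaAlgebra.isLocalRing_quotient_X_pow_add_C p hm
    (W.eisensteinTower κ hm).redIter k d (a • x) =
      IwasawaAlgebra.EisensteinCoeff.reduce p m (Nat.succ_le_succ (Nat.le_add_right k d)) a •
        (W.eisensteinTower κ hm).redIter k d x := by
  letI := IwasawaAlgebra.isLocalRing_quotient_X_pow_add_C p hm
  obtain ⟨r, rfl⟩ := IwasawaAlgebra.EisensteinCoeff.ofSpec_surjective (p := p) m (k + d + 1) a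
  letI := IwasawaAlgebra.EisensteinCoeff.algebraOfSpecSucc p m (k + d)
  haveI := W.isScalarTower_algebraOfSpecSucc (K := K) (p := p) (m := m) (k + d)
  have h1 : IwasawaAlgebra.EisensteinCoeff.ofSpec p m (k + d + 1) r • x = r • x := algebraMap_smul _ r x
  have h2 : IwasawaAlgebra.EisensteinCoeff.ofSpec p m (k + 1) r • (W.eisensteinTower κ hm).redIter k d x =
      r • (W.eisensteinTower κ hm).redIter k d x := by
    letI := IwasawaAlgebra.EisensteinCoeff.algebraOfSpecSucc p m k
    haveI := W.isScalarTower_algebraOfSpecSucc (K := K) (p := p) (m := m) k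
    exact algebraMap_smul _ r _
  rw [IwasawaAlgebra.EisensteinCoeff.reduce_ofSpec, h1, h2, LinearMap.map_smul]

/-- **`range H¹(K_v, Tw red^{(d)})` is stable under the scalar action of `A_{m,k+1}`** — the hypothesis `hT` of
`DualityDatum.mem_of_forall_localCup_annihilator_eq_zero_of_isPerfect` at Howard's images (local conditions are
`R`-submodules). [cite: Howard2004HeegnerKolyvagin, §1.3 H.4 and Def. 1.1.1] [cite: SerreGaloisCohomology1997, I §2.2 and §5.1] -/
theorem eisensteinTower_scalarMapH1_mem_range_twist_redIter (cd : ConjugationDatum K) (k d : ℕ) (v : Place K)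
    {ι : Type} (rfam : ι → IwasawaAlgebra.EisensteinCoeff p m (k + 1)) (i : ι)
    (t : letI := IwasawaAlgebra.isLocalRing_quotient_X_pow_add_C p hm
      galoisCohomology ((cd.twist ((W.eisensteinTower κ hm).ρ k)).toLocal v) 1)
    (ht : letI := IwasawaAlgebra.isLocalRing_quotient_X_pow_add_C p hm
      t ∈ (ContinuousRep.cohomologyMap ((cd.twist ((W.eisensteinTower κ hm).ρ (k + d))).toLocal v)
        ((cd.twist ((W.eisensteinTower κ hm).ρ k)).toLocal v) ((W.eisensteinTower κ hm).redIter k d).toAddMonoidHom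
        continuous_of_discreteTopology (fun _ z => (W.eisensteinTower κ hm).redIter_equivariant k d _ z) 1).range) :
    letI := IwasawaAlgebra.isLocalRing_quotient_X_pow_add_C p hm
    galoisCohomology.scalarMapH1 ((cd.twist ((W.eisensteinTower κ hm).ρ k)).toLocal v)
        (DualityDatum.isScalarLinear_twist_toLocal cd
          (κ.isScalarLinear_eisensteinAdicTowerSucc_coeff (fun j ↦ (W.baseChange K).torsionGaloisModule ((p : ℤ) ^ j))
            (fun j ↦ (W.baseChange K).torsionGaloisModuleReduce p j) hm
            (fun j ↦ (W.baseChange K).torsionGaloisModuleReduce_surjective p j) k) v) (rfam i) t ∈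
      (ContinuousRep.cohomologyMap ((cd.twist ((W.eisensteinTower κ hm).ρ (k + d))).toLocal v)
        ((cd.twist ((W.eisensteinTower κ hm).ρ k)).toLocal v) ((W.eisensteinTower κ hm).redIter k d).toAddMonoidHom
        continuous_of_discreteTopology (fun _ z => (W.eisensteinTower κ hm).redIter_equivariant k d _ z) 1).range := by
  letI := IwasawaAlgebra.isLocalRing_quotient_X_pow_add_C p hm
  exact DualityDatum.scalarMapH1_twist_toLocal_mem_range (cd := cd)
    (κ.isScalarLinear_eisensteinAdicTowerSucc_coeff _ _ hm _ k)
    (κ.isScalarLinear_eisensteinAdicTowerSucc_coeff _ _ hm _ (k + d))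
    ((W.eisensteinTower κ hm).redIter k d).toAddMonoidHom
    (fun g z => (W.eisensteinTower κ hm).redIter_equivariant k d g z) _
    (IwasawaAlgebra.EisensteinCoeff.reduce_surjective m _)
    (fun a z => W.eisensteinTower_redIter_smul κ hm k d a z) v rfam i t ht

/-! ### §3 (Perf) and (Nondeg) for the induced local pairing of level `k` -/

variable (cd : ConjugationDatum K)
  (D : letI := IwasawaAlgebra.isLocalRing_quotient_X_pow_add_C p hm
    ∀ k, DualityDatum p cd ((W.eisensteinTower κ hm).ρ k) (IwasawaAlgebra.EisensteinCoeff p m (k + 1)))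

/-- **(Perf) at the images of the iterated reductions.**  At a finite place `v`, for ANY H.4 data `D k` of the curve's
tower: a class `y ∈ H¹(K_v, Tw T^{(k)})` orthogonal (under `∪_k`) to every class orthogonal to `range H¹(K_v, Tw red^{(d)})` lies
in that range — finite-level Tate duality (`poitouTate_selmerStructure_duality K`, hypothesis) read through the dualizing
family of `A_{m,k+1}`, the range being `A_{m,k+1}`-stable (§2).
[cite: Howard2004HeegnerKolyvagin, §1.3 H.4 (arXiv p. 7, L78–82) and Def. 1.1.1] [cite: MilneADT2006, Ch. I §0 Prop. 0.19 and Cor. 2.3] -/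
theorem eisensteinTower_mem_range_of_forall_localCup_annihilator (hPT : poitouTate_selmerStructure_duality K)
    (k d : ℕ) (v : HeightOneSpectrum (𝓞 K))
    (y : letI := IwasawaAlgebra.isLocalRing_quotient_X_pow_add_C p hm
      galoisCohomology ((cd.twist ((W.eisensteinTower κ hm).ρ k)).toLocal (Sum.inr v)) 1)
    (hy : letI := IwasawaAlgebra.isLocalRing_quotient_X_pow_add_C p hm
      ∀ x : galoisCohomology (((W.eisensteinTower κ hm).ρ k).toLocal (Sum.inr v)) 1,
        (∀ t ∈ (ContinuousRep.cohomologyMap ((cd.twist ((W.eisensteinTower κ hm).ρ (k + d))).toLocal (Sum.inr v))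
            ((cd.twist ((W.eisensteinTower κ hm).ρ k)).toLocal (Sum.inr v))
            ((W.eisensteinTower κ hm).redIter k d).toAddMonoidHom continuous_of_discreteTopology
            (fun _ z => (W.eisensteinTower κ hm).redIter_equivariant k d _ z) 1).range,
          (D k).localCup (Sum.inr v) x t = 0) →
        (D k).localCup (Sum.inr v) x y = 0) :
    letI := IwasawaAlgebra.isLocalRing_quotient_X_pow_add_C p hm
    y ∈ (ContinuousRep.cohomologyMap ((cd.twist ((W.eisensteinTower κ hm).ρ (k + d))).toLocal (Sum.inr v))
      ((cd.twist ((W.eisensteinTower κ hm).ρ k)).toLocal (Sum.inr v))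
      ((W.eisensteinTower κ hm).redIter k d).toAddMonoidHom continuous_of_discreteTopology
      (fun _ z => (W.eisensteinTower κ hm).redIter_equivariant k d _ z) 1).range := by
  letI := IwasawaAlgebra.isLocalRing_quotient_X_pow_add_C p hm
  have hpp := hp.out
  haveI : NeZero (p ^ (k + 1)) := ⟨pow_ne_zero _ hpp.ne_zero⟩
  have hpK : (p : K) ≠ 0 := by exact_mod_cast hpp.ne_zero
  haveI : Finite (geomTorsion (W.baseChange K) ((p : ℤ) ^ (k + 1))) :=
    finite_torsionPoints_holds (W.baseChange K) (AlgebraicClosure K) (n := (p : ℤ) ^ (k + 1))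
      (pow_ne_zero _ (by exact_mod_cast hpp.ne_zero))
  haveI : Finite (EisensteinLevel p m (fun j ↦ geomTorsion (W.baseChange K) ((p : ℤ) ^ j)) (k + 1)) :=
    IwasawaAlgebra.EisensteinCoeff.finite_twisted (p := p) (k := k + 1)
      (M := geomTorsion (W.baseChange K) ((p : ℤ) ^ (k + 1))) hm
  have hM := W.eisensteinLevel_succ_pow_nsmul_eq_zero (K := K) (p := p) hm k
  -- the bridge data `λ = λ_{k+1}` (tail form) and `exp = log⁻¹`
  have hlam : ∀ (z : ℤ_[p]) (r : IwasawaAlgebra.EisensteinCoeff p m (k + 1)),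
      (IwasawaAlgebra.EisensteinCoeff.tailFormZMod p hm (k + 1)).toAddMonoidHom
          (algebraMap ℤ_[p] (IwasawaAlgebra.EisensteinCoeff p m (k + 1)) z * r) =
        PadicInt.toZModPow (k + 1) z *
          (IwasawaAlgebra.EisensteinCoeff.tailFormZMod p hm (k + 1)).toAddMonoidHom r := fun z r ↦ by
    rw [LinearMap.toAddMonoidHom_coe, IwasawaAlgebra.EisensteinCoeff.algebraMap_padicInt_eq_ofZMod_toZModPow p hm (k + 1),
      IwasawaAlgebra.EisensteinCoeff.tailFormZMod_ofZMod_mul]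
  obtain ⟨log, hlogbij, hlogχ, -⟩ := exists_compatible_muLog K p hpK
  let Lg : MuCarrier K (p ^ (k + 1)) ≃+ ZMod (p ^ (k + 1)) := AddEquiv.ofBijective (log (k + 1)) (hlogbij (k + 1))
  have hexpb : Function.Bijective (Lg.symm : ZMod (p ^ (k + 1)) →+ MuCarrier K (p ^ (k + 1))) := Lg.symm.bijective
  have hexp : ∀ (g : absoluteGaloisGroup K) (x : ZMod (p ^ (k + 1))),
      (Lg.symm : ZMod (p ^ (k + 1)) →+ MuCarrier K (p ^ (k + 1))) (cyclotomicCharacterModPow K p (k + 1) g * x) =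
        mu K (p ^ (k + 1)) g ((Lg.symm : ZMod (p ^ (k + 1)) →+ MuCarrier K (p ^ (k + 1))) x) := fun g x ↦ by
    apply Lg.injective
    change Lg (Lg.symm _) = log (k + 1) (mu K _ g (Lg.symm x))
    rw [AddEquiv.apply_symm_apply, hlogχ, show log (k + 1) (Lg.symm x) = Lg (Lg.symm x) from rfl,
      AddEquiv.apply_symm_apply]
  -- `Θ : Tw(T^{(k)}) → Hom(T^{(k)}, μ)` is bijective, and the dual family dualizes `A_{m,k+1}(1)`
  have hΘ := (D k).toTateDual_bijective _ hlam _ hexp hexpb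
    (IwasawaAlgebra.EisensteinCoeff.tailFormZModComp_bijective p hm (k + 1))
  have hbij := IwasawaAlgebra.EisensteinCoeff.bijective_comp_tailFormZMod_dualFamily_mul p hm (k + 1) _ hexpb
  -- the Poitou–Tate family of local invariants at `n = p^{k+1}`
  obtain ⟨inv, hperf, -, -, -⟩ := hPT (p ^ (k + 1))
  exact (D k).mem_of_forall_localCup_annihilator_eq_zero_of_isPerfect _ hlam _ hexp
    (κ.isScalarLinear_eisensteinAdicTowerSucc_coeff _ _ hm _ k) v hM hΘ inv hperf
    (IwasawaAlgebra.EisensteinCoeff.dualFamily p hm (k + 1)) hbij _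
    (fun i t ht ↦ W.eisensteinTower_scalarMapH1_mem_range_twist_redIter κ hm cd k d (Sum.inr v)
      (IwasawaAlgebra.EisensteinCoeff.dualFamily p hm (k + 1)) i t ht) y hy

/-- **(Nondeg) both kernels of the induced local pairing `∪_k` of the curve's tower are trivial** at a finite place, for ANY
H.4 data `D k` (finite-level Tate duality via `poitouTate_selmerStructure_duality K`, hypothesis, and `Θ` bijective).
[cite: Howard2004HeegnerKolyvagin, §1.3 H.4 (arXiv p. 7, L78–82)] [cite: MilneADT2006, Ch. I, Cor. 2.3] -/
theorem eisensteinTower_localCup_nondegenerate (hPT : poitouTate_selmerStructure_duality K) (k : ℕ)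
    (v : HeightOneSpectrum (𝓞 K)) :
    letI := IwasawaAlgebra.isLocalRing_quotient_X_pow_add_C p hm
    (∀ x : galoisCohomology (((W.eisensteinTower κ hm).ρ k).toLocal (Sum.inr v)) 1,
        (∀ y : galoisCohomology ((cd.twist ((W.eisensteinTower κ hm).ρ k)).toLocal (Sum.inr v)) 1,
          (D k).localCup (Sum.inr v) x y = 0) → x = 0) ∧
      ∀ y : galoisCohomology ((cd.twist ((W.eisensteinTower κ hm).ρ k)).toLocal (Sum.inr v)) 1,
        (∀ x : galoisCohomology (((W.eisensteinTower κ hm).ρ k).toLocal (Sum.inr v)) 1,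
          (D k).localCup (Sum.inr v) x y = 0) → y = 0 := by
  letI := IwasawaAlgebra.isLocalRing_quotient_X_pow_add_C p hm
  have hpp := hp.out
  haveI : NeZero (p ^ (k + 1)) := ⟨pow_ne_zero _ hpp.ne_zero⟩
  have hpK : (p : K) ≠ 0 := by exact_mod_cast hpp.ne_zero
  haveI : Finite (geomTorsion (W.baseChange K) ((p : ℤ) ^ (k + 1))) :=
    finite_torsionPoints_holds (W.baseChange K) (AlgebraicClosure K) (n := (p : ℤ) ^ (k + 1))
      (pow_ne_zero _ (by exact_mod_cast hpp.ne_zero))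
  haveI : Finite (EisensteinLevel p m (fun j ↦ geomTorsion (W.baseChange K) ((p : ℤ) ^ j)) (k + 1)) :=
    IwasawaAlgebra.EisensteinCoeff.finite_twisted (p := p) (k := k + 1)
      (M := geomTorsion (W.baseChange K) ((p : ℤ) ^ (k + 1))) hm
  have hM := W.eisensteinLevel_succ_pow_nsmul_eq_zero (K := K) (p := p) hm k
  have hlam : ∀ (z : ℤ_[p]) (r : IwasawaAlgebra.EisensteinCoeff p m (k + 1)),
      (IwasawaAlgebra.EisensteinCoeff.tailFormZMod p hm (k + 1)).toAddMonoidHom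
          (algebraMap ℤ_[p] (IwasawaAlgebra.EisensteinCoeff p m (k + 1)) z * r) =
        PadicInt.toZModPow (k + 1) z *
          (IwasawaAlgebra.EisensteinCoeff.tailFormZMod p hm (k + 1)).toAddMonoidHom r := fun z r ↦ by
    rw [LinearMap.toAddMonoidHom_coe, IwasawaAlgebra.EisensteinCoeff.algebraMap_padicInt_eq_ofZMod_toZModPow p hm (k + 1),
      IwasawaAlgebra.EisensteinCoeff.tailFormZMod_ofZMod_mul]
  obtain ⟨log, hlogbij, hlogχ, -⟩ := exists_compatible_muLog K p hpK
  let Lg : MuCarrier K (p ^ (k + 1)) ≃+ ZMod (p ^ (k + 1)) := AddEquiv.ofBijective (log (k + 1)) (hlogbij (k + 1))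
  have hexpb : Function.Bijective (Lg.symm : ZMod (p ^ (k + 1)) →+ MuCarrier K (p ^ (k + 1))) := Lg.symm.bijective
  have hexp : ∀ (g : absoluteGaloisGroup K) (x : ZMod (p ^ (k + 1))),
      (Lg.symm : ZMod (p ^ (k + 1)) →+ MuCarrier K (p ^ (k + 1))) (cyclotomicCharacterModPow K p (k + 1) g * x) =
        mu K (p ^ (k + 1)) g ((Lg.symm : ZMod (p ^ (k + 1)) →+ MuCarrier K (p ^ (k + 1))) x) := fun g x ↦ by
    apply Lg.injective
    change Lg (Lg.symm _) = log (k + 1) (mu K _ g (Lg.symm x))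
    rw [AddEquiv.apply_symm_apply, hlogχ, show log (k + 1) (Lg.symm x) = Lg (Lg.symm x) from rfl,
      AddEquiv.apply_symm_apply]
  have hΘ := (D k).toTateDual_bijective _ hlam _ hexp hexpb
    (IwasawaAlgebra.EisensteinCoeff.tailFormZModComp_bijective p hm (k + 1))
  obtain ⟨inv, hperf, -, -, -⟩ := hPT (p ^ (k + 1))
  exact (D k).eq_zero_of_forall_localCup_eq_zero_of_isPerfect _ hlam _ hexp v hM hΘ inv hperf

/-! ### §4 (Perf) and (Nondeg) in the binder shapes of `Tower.mem_levelCondition_top_of_forall_pairing_bot_eq_zero_of_range` -/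

/-- **The duality level inputs of the H.4 descent for the curve's Eisenstein setting at a finite place `v`**: for the
`D`-indexed towers `X_j = H¹(K_v, T^{(j)})`, `Y_j = H¹(K_v, Tw T^{(j)})` (one-step maps `H¹(red_j)`), pairings
`B_j = (D j).localCup (Sum.inr v)`, and every base level `k`: (Perf) at the images `range (red′^{(d)})` and (Nondeg) at every
level `k + d` — the hypotheses `hPerf`, `hNondeg` of `Tower.mem_levelCondition_top_of_forall_pairing_bot_eq_zero_of_range`,
given the Poitou–Tate named fact. [cite: Howard2004HeegnerKolyvagin, §1.3 H.4 (arXiv p. 7, L78–82), Def. 1.1.1 and Def. 3.1.2]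
[cite: MilneADT2006, Ch. I §0 Prop. 0.19 and Cor. 2.3] -/
theorem eisensteinTower_localCup_towerDuality (hPT : poitouTate_selmerStructure_duality K)
    (v : HeightOneSpectrum (𝓞 K)) (k : ℕ) :
    letI := IwasawaAlgebra.isLocalRing_quotient_X_pow_add_C p hm
    (∀ (d : ℕ) (y : galoisCohomology ((cd.twist ((W.eisensteinTower κ hm).ρ k)).toLocal (Sum.inr v)) 1),
        (∀ x : galoisCohomology (((W.eisensteinTower κ hm).ρ k).toLocal (Sum.inr v)) 1,
          (∀ t ∈ (Tower.redIter (H := fun j ↦ galoisCohomology ((cd.twist ((W.eisensteinTower κ hm).ρ j)).toLocal (Sum.inr v)) 1)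
              (fun j ↦ ContinuousRep.cohomologyMap ((cd.twist ((W.eisensteinTower κ hm).ρ (j + 1))).toLocal (Sum.inr v))
                ((cd.twist ((W.eisensteinTower κ hm).ρ j)).toLocal (Sum.inr v)) ((W.eisensteinTower κ hm).red j).toAddMonoidHom
                continuous_of_discreteTopology (fun _ z => (W.eisensteinTower κ hm).red_equivariant j _ z) 1) k d).range,
            (D k).localCup (Sum.inr v) x t = 0) → (D k).localCup (Sum.inr v) x y = 0) →
        y ∈ (Tower.redIter (H := fun j ↦ galoisCohomology ((cd.twist ((W.eisensteinTower κ hm).ρ j)).toLocal (Sum.inr v)) 1)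
          (fun j ↦ ContinuousRep.cohomologyMap ((cd.twist ((W.eisensteinTower κ hm).ρ (j + 1))).toLocal (Sum.inr v))
            ((cd.twist ((W.eisensteinTower κ hm).ρ j)).toLocal (Sum.inr v)) ((W.eisensteinTower κ hm).red j).toAddMonoidHom
            continuous_of_discreteTopology (fun _ z => (W.eisensteinTower κ hm).red_equivariant j _ z) 1) k d).range) ∧
      ∀ (d : ℕ) (x : galoisCohomology (((W.eisensteinTower κ hm).ρ (k + d)).toLocal (Sum.inr v)) 1),
        (∀ w : galoisCohomology ((cd.twist ((W.eisensteinTower κ hm).ρ (k + d))).toLocal (Sum.inr v)) 1,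
          (D (k + d)).localCup (Sum.inr v) x w = 0) → x = 0 := by
  letI := IwasawaAlgebra.isLocalRing_quotient_X_pow_add_C p hm
  refine ⟨fun d y hy ↦ ?_, fun d x hx ↦ (W.eisensteinTower_localCup_nondegenerate κ hm cd D hPT (k + d) v).1 x hx⟩
  rw [(W.eisensteinTower κ hm).redIter_cohomologyMap_twist_toLocal_eq' cd (Sum.inr v) k d] at hy ⊢
  exact W.eisensteinTower_mem_range_of_forall_localCup_annihilator κ hm cd D hPT k d v y hy

end WeierstrassCurve

end
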